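import Summits.MatrixMultiplication.MatrixMultiplication.Theorems.AbelianSTPPCensusTAStatFDefs
import Summits.MatrixMultiplication.MatrixMultiplication.Theorems.AbelianSTPPCensusTAStatLemmas

/-!
# T_A static certificate, range `6780 … 6833` (k-member tree): data facts and structural soundness

Cell mm-stpp (rung F-M1), tier T_A = «beat `2.371`, the record exponent (ADVXXZ'25 / DEK+26 rounded)»; checker `AbelianSTPPCensusTAStatFDefs.lean`.  Theory g12's `AbelianSTPPCensusTAStatDRows.lean` at the universe `6833`
in the namespace `TAStatF` (data `TAStatFData`, gains `ShapeCert.gainOf2371j`; numerals `6379 / 361 / 343 / (18, 79)` → `6833 / 390 / 390 / (18, 82)`; the bucket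
facts are checked here by evaluation instead of imported through bridges; statements spell `TAStatF.`/`TAStatFData.` explicitly), plus the small facts the tree's
soundness consumes (`tb_pos`, `bucketOf_tb_pred`, `m2f_all`, `tb_le_succ`, `tb_lt_million`, `bucketOf_eq_of_mem`).  Contents: data facts by evaluation (`levOf_spec`, `levOf_step`,
`bucketOf_specD`, `bucketOf_monoD`, `tb_step`, `tb_two`, `tb_sq`, `row_length`, `sentinel`), `tp_facts`, `mem_triplesS`, `exists_sorted`, `domV_sound` / `checkV_sound` /
`m2V_sound` / `domWrow_sound` / `domXTV_sound` / `domXTrow_sound` / `xdenOK_sound` (continued in `AbelianSTPPCensusTAStatFRows2.lean`: `mono_P_lev` / `mono_P_bkt` / `mono_W_lev`, `dominated`, the tree helpers).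
WHAT THIS IS NOT: arithmetic about the checker only; no statement about STPP families or `ω`.
-/

set_option linter.dupNamespace false
set_option autoImplicit false

namespace Summit.MatrixMultiplication.MatrixMultiplication.Theorems.TAStatF

open TECert (tableOK vol us tableOK_iff)
open ShapeCert (gainOf2371j D)
open TAStatFData (E VL TB nl nb)
open TAStat (tm Entry e0 domP leP leW vpI p1I p2I p3I piece pcs vpCand vpThresh cover tm_sorted getD_drop_add pcs_sound)

/-! ## Facts about the concrete data (by evaluation) -/
set_option maxHeartbeats 2000000 in
/-- `levOf_spec`, lower half (the bounded quantifier is split to keep the kernel recursion shallow) -/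
theorem levOf_spec_a : ∀ V ≤ 3416, TAStatF.levOf V < TAStatFData.nl ∧ V ≤ TAStatFData.VL.getD (TAStatF.levOf V) 0 := by decide +kernel
set_option maxHeartbeats 2000000 in
/-- `levOf_spec`, upper half -/
theorem levOf_spec_b : ∀ k ≤ 3417, TAStatF.levOf (3416 + k) < TAStatFData.nl ∧ 3416 + k ≤ TAStatFData.VL.getD (TAStatF.levOf (3416 + k)) 0 := by decide +kernel
/-- every volume `V ≤ Mtop` has a level, and the level covers it -/
theorem levOf_spec : ∀ V ≤ 6833, TAStatF.levOf V < TAStatFData.nl ∧ V ≤ TAStatFData.VL.getD (TAStatF.levOf V) 0 := by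
  intro V hV
  by_cases h : V ≤ 3416
  · exact levOf_spec_a V h
  · have := levOf_spec_b (V - 3416) (by omega)
    rwa [show 3416 + (V - 3416) = V by omega] at this
set_option maxHeartbeats 2000000 in
/-- `levOf_step`, lower half -/
theorem levOf_step_a : ∀ V < 3416, TAStatF.levOf V ≤ TAStatF.levOf (V + 1) := by decide +kernel
set_option maxHeartbeats 2000000 in
/-- `levOf_step`, upper half -/
theorem levOf_step_b : ∀ k < 3417, TAStatF.levOf (3416 + k) ≤ TAStatF.levOf (3416 + k + 1) := by decide +kernel
/-- `levOf` is monotone, one step -/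
theorem levOf_step : ∀ V < 6833, TAStatF.levOf V ≤ TAStatF.levOf (V + 1) := by
  intro V hV
  by_cases h : V < 3416
  · exact levOf_step_a V h
  · have := levOf_step_b (V - 3416) (by omega)
    rwa [show 3416 + (V - 3416) = V by omega] at this
/-- `levOf` is monotone on `[0, Mtop]` -/
theorem levOf_mono {V V' : ℕ} (h : V ≤ V') (h' : V' ≤ 6833) : TAStatF.levOf V ≤ TAStatF.levOf V' := by
  induction V', h using Nat.le_induction with
  | base => exact le_rfl
  | succ n hn ih => exact (ih (by omega)).trans (levOf_step n (by omega))
/-- every parameter `1 ≤ t ≤ 390` has a bucket `j < nb` with `TB[j] ≤ t < TB[j+1]` -/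
theorem bucketOf_spec : ∀ t ≤ 390, 1 ≤ t →
    TAStatF.bucketOf t < TAStatFData.nb ∧ TAStatF.tb (TAStatF.bucketOf t) ≤ t ∧ t < TAStatF.tb (TAStatF.bucketOf t + 1) := by decide +kernel
/-- packaged with implicit parameter -/
theorem bucketOf_specD {t : ℕ} (ht : t ≤ 390) (h1 : 1 ≤ t) :
    TAStatF.bucketOf t < TAStatFData.nb ∧ TAStatF.tb (TAStatF.bucketOf t) ≤ t ∧ t < TAStatF.tb (TAStatF.bucketOf t + 1) := bucketOf_spec t ht h1
/-- `bucketOf` is monotone, one step -/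
theorem bucketOf_step : ∀ t ≤ 389, TAStatF.bucketOf t ≤ TAStatF.bucketOf (t + 1) := by decide +kernel
/-- `bucketOf` is monotone on `[0, 390]` -/
theorem bucketOf_monoD {t t' : ℕ} (h : t ≤ t') (h' : t' ≤ 390) : TAStatF.bucketOf t ≤ TAStatF.bucketOf t' := by
  induction t', h using Nat.le_induction with
  | base => exact le_rfl
  | succ n hn ih => exact (ih (by omega)).trans (bucketOf_step n (by omega))
/-- the bucket lower ends are positive -/
theorem tb_pos : ∀ j ≤ TAStatFData.nb, 1 ≤ TAStatF.tb j := by decide +kernel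
/-- the bucket of `TB[j+1] − 1` is `j` -/
theorem bucketOf_tb_pred : ∀ j < TAStatFData.nb, TAStatF.bucketOf (TAStatF.tb (j + 1) - 1) = j := by decide +kernel
/-- every bucket carries a complete list -/
theorem m2f_all : ∀ j < TAStatFData.nb, TAStatF.m2f j = true := by decide +kernel
/-- `nb = 75`, `TB[nb] = 391` -/
theorem tb_nb : TAStatFData.nb = 75 ∧ TAStatF.tb TAStatFData.nb = 391 := ⟨rfl, by decide⟩
/-- beyond the list `tb` is the default `1000` -/
theorem tb_default : ∀ j, 76 ≤ j → TAStatF.tb j = 1000 := by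
  intro j hj
  unfold TAStatF.tb
  rw [List.getD_eq_default]
  exact (show TAStatFData.TB.length = 76 by rfl) ▸ hj
/-- `tb` is monotone at every index -/
theorem tb_le_succ : ∀ j, TAStatF.tb j ≤ TAStatF.tb (j + 1) := by
  intro j
  by_cases h : j ≤ 75
  · exact (show ∀ j ≤ 75, TAStatF.tb j ≤ TAStatF.tb (j + 1) by decide +kernel) j h
  · rw [tb_default j (by omega), tb_default (j + 1) (by omega)]
/-- `tb` stays below `10⁶` at every index -/
theorem tb_lt_million : ∀ j, TAStatF.tb j < 1000000 := by
  intro j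
  by_cases h : j ≤ 75
  · exact (show ∀ j ≤ 75, TAStatF.tb j < 1000000 by decide +kernel) j h
  · rw [tb_default j (by omega)]; omega
/-- the bucket lower ends increase -/
theorem tb_step : ∀ j < TAStatFData.nb, TAStatF.tb j < TAStatF.tb (j + 1) := by decide +kernel

/-- … at most double -/
theorem tb_two : ∀ j < TAStatFData.nb, TAStatF.tb (j + 1) ≤ 2 * TAStatF.tb j := by decide +kernel

/-- … and at most square, from `3` on -/
theorem tb_sq : ∀ j < TAStatFData.nb, 3 ≤ TAStatF.tb j → TAStatF.tb (j + 1) ≤ TAStatF.tb j * TAStatF.tb j := by decide +kernel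

/-- the bucket lower ends are monotone -/
theorem tb_mono {j j' : ℕ} (h : j ≤ j') (h' : j' ≤ TAStatFData.nb) : TAStatF.tb j ≤ TAStatF.tb j' := by
  induction j', h using Nat.le_induction with
  | base => exact le_rfl
  | succ n hn ih => exact (ih (by omega)).trans (tb_step n (by omega)).le

/-- a parameter lying in bucket `j` has `bucketOf = j` -/
theorem bucketOf_eq_of_mem {t j : ℕ} (hj : j < TAStatFData.nb) (h1 : TAStatF.tb j ≤ t) (h2 : t ≤ TAStatF.tb (j + 1) - 1) :
    TAStatF.bucketOf t = j := by
  have htb := tb_nb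
  have ht1 : 1 ≤ t := le_trans (tb_pos j hj.le) h1
  have htop : TAStatF.tb (j + 1) ≤ TAStatF.tb TAStatFData.nb := tb_mono (by omega) le_rfl
  obtain ⟨hlt, hle, hgt⟩ := bucketOf_specD (t := t) (by omega) ht1
  by_contra hne
  rcases Nat.lt_or_gt_of_ne hne with hlt' | hgt'
  · have := tb_mono (show TAStatF.bucketOf t + 1 ≤ j from hlt') hj.le
    omega
  · have := tb_mono (show j + 1 ≤ TAStatF.bucketOf t from hgt') hlt.le
    omega

/-- every row of the table has `nb` entries -/
theorem row_length : ∀ i < TAStatFData.nl, (TAStatFData.E.getD i []).length = TAStatFData.nb := by decide +kernel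

/-- the sentinel: `t³ ≤ Mtop²` forces `t ≤ 360 < TB[nb] = 391` -/
theorem sentinel {t : ℕ} (h : t ^ 3 ≤ 6833 ^ 2) : t ≤ 360 := by
  by_contra hc
  have h1 : 361 ^ 3 ≤ t ^ 3 := Nat.pow_le_pow_left (by omega) 3
  have h2 : (6833 : ℕ) ^ 2 < 361 ^ 3 := by norm_num
  omega

/-- numerals -/
theorem nl_eq : TAStatFData.nl = 50 := rfl
/-- the budget parameters: `TP[j] = TB[j]` or `19 ≤ TP[j]`, and `TP[j] ≤ TB[j]` (read off `monoOK`) -/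
theorem tp_facts (hmono : TAStatF.monoOK TAStatFData.nl TAStatFData.nb = true) :
    ∀ j < TAStatFData.nb, (TAStatF.tp j = TAStatF.tb j ∨ 19 ≤ TAStatF.tp j) ∧ TAStatF.tp j ≤ TAStatF.tb j := by
  intro j hj
  simp only [monoOK, Bool.and_eq_true, List.all_eq_true, List.mem_range, Bool.or_eq_true, Nat.beq_eq, Nat.ble_eq,
    Nat.blt_eq] at hmono
  obtain ⟨-, h3⟩ := hmono
  obtain ⟨⟨-, h5⟩, h6⟩ := h3 j hj
  exact ⟨h5, h6⟩

/-! ## The candidate enumeration is complete for sorted candidates -/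

/-- A sorted candidate shape is listed under its volume. [bookkeeping] -/
theorem mem_triplesS {a b c : ℕ} (h : TAStatF.SCand (a, b, c)) : (a, b, c) ∈ TAStatF.triplesS (a * b * c) := by
  obtain ⟨ha, hab, hbc, ht⟩ := h
  simp only at ha hab hbc ht
  have hV : a * b * c ≤ 6833 := by
    have := (tableOK_iff _ _ _ _).1 ht
    exact this.1
  have hb : 1 ≤ b := le_trans ha hab
  have hc : 1 ≤ c := le_trans hb hbc
  have ha17 : a ≤ 18 := by
    by_contra hlt
    have h1 : 19 * 19 * 19 ≤ a * b * c :=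
      Nat.mul_le_mul (Nat.mul_le_mul (by omega) (by omega)) (by omega)
    omega
  have hb75 : b ≤ 82 := by
    by_contra hlt
    have h1 : 1 * 83 * 83 ≤ a * b * c := Nat.mul_le_mul (Nat.mul_le_mul ha (by omega)) (by omega)
    omega
  have hVa : a * b * c / a = b * c := by rw [mul_assoc]; exact Nat.mul_div_cancel_left _ (by omega)
  have hVab : b * c / b = c := Nat.mul_div_cancel_left _ (by omega)
  simp only [triplesS, List.mem_flatMap, List.mem_range]
  refine ⟨a - 1, by omega, ?_⟩
  rw [Nat.sub_add_cancel ha, if_pos (by rw [mul_assoc]; exact Nat.mul_mod_right _ _), List.mem_filterMap]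
  refine ⟨b - 1, by rw [List.mem_range]; omega, ?_⟩
  rw [Nat.sub_add_cancel hb, hVa, hVab]
  rw [if_pos ⟨by omega, Nat.mul_mod_right _ _, hbc, ht⟩]

/-! ## Sorted forms (this universe's `SCand`) -/

/-- Every shape with sizes `≥ 1` passing the table at `Mtop` has a sorted candidate form `y` with the same volume, pair-product sum and size sum,
whose first two entries are the smallest size and the smaller of the other two, in one of the three letter positions. [bookkeeping] -/
theorem exists_sorted (a b c : ℕ) (ha : 1 ≤ a) (hb : 1 ≤ b) (hc : 1 ≤ c) (ht : tableOK TAStatF.Mtop a b c = true) :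
    ∃ y : ℕ × ℕ × ℕ, TAStatF.SCand y ∧ vol y = a * b * c ∧ us y = a * b + b * c + c * a ∧ y.1 + y.2.1 + y.2.2 = a + b + c ∧
      ((y.1 = a ∧ y.2.1 = min c b ∧ a ≤ c ∧ a ≤ b) ∨ (y.1 = b ∧ y.2.1 = min a c ∧ b ≤ a ∧ b ≤ c) ∨
        (y.1 = c ∧ y.2.1 = min b a ∧ c ≤ b ∧ c ≤ a)) := by
  rcases le_total a b with hab | hab <;> rcases le_total b c with hbc | hbc <;> rcases le_total a c with hac | hac
  · exact ⟨(a, b, c), ⟨ha, hab, hbc, ht⟩, rfl, rfl, rfl, Or.inl ⟨rfl, by show b = min c b; rw [min_eq_right hbc], hac, hab⟩⟩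
  · exact ⟨(a, b, c), ⟨ha, hab, hbc, ht⟩, rfl, rfl, rfl, Or.inl ⟨rfl, by show b = min c b; rw [min_eq_right hbc], le_trans hab hbc, hab⟩⟩
  · exact ⟨(a, c, b), ⟨ha, hac, hbc, TALin1200.tableOK_swap23 ht⟩, by show a * c * b = a * b * c; ring,
      by show a * c + c * b + b * a = a * b + b * c + c * a; ring, by show a + c + b = a + b + c; ring,
      Or.inl ⟨rfl, by show c = min c b; rw [min_eq_left hbc], hac, hab⟩⟩
  · exact ⟨(c, a, b), ⟨hc, hac, hab, TALin1200.tableOK_swap23 (TALin1200.tableOK_swap13 ht)⟩, by show c * a * b = a * b * c; ring,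
      by show c * a + a * b + b * c = a * b + b * c + c * a; ring, by show c + a + b = a + b + c; ring,
      Or.inr (Or.inr ⟨rfl, by show a = min b a; rw [min_eq_right hab], le_trans hac hab, hac⟩)⟩
  · exact ⟨(b, a, c), ⟨hb, hab, hac, TALin1200.tableOK_swap12 ht⟩, by show b * a * c = a * b * c; ring,
      by show b * a + a * c + c * b = a * b + b * c + c * a; ring, by show b + a + c = a + b + c; ring,
      Or.inr (Or.inl ⟨rfl, by show a = min a c; rw [min_eq_left hac], hab, hbc⟩)⟩
  · exact ⟨(b, c, a), ⟨hb, hbc, hac, TALin1200.tableOK_swap23 (TALin1200.tableOK_swap12 ht)⟩, by show b * c * a = a * b * c; ring,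
      by show b * c + c * a + a * b = a * b + b * c + c * a; ring, by show b + c + a = a + b + c; ring,
      Or.inr (Or.inl ⟨rfl, by show c = min a c; rw [min_eq_right hac], hab, hbc⟩)⟩
  · exact ⟨(c, b, a), ⟨hc, hbc, hab, TALin1200.tableOK_swap13 ht⟩, by show c * b * a = a * b * c; ring,
      by show c * b + b * a + a * c = a * b + b * c + c * a; ring, by show c + b + a = a + b + c; ring,
      Or.inr (Or.inr ⟨rfl, by show b = min b a; rw [min_eq_left hab], hbc, le_trans hbc hab⟩)⟩
  · exact ⟨(c, b, a), ⟨hc, hbc, hab, TALin1200.tableOK_swap13 ht⟩, by show c * b * a = a * b * c; ring,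
      by show c * b + b * a + a * c = a * b + b * c + c * a; ring, by show c + b + a = a + b + c; ring,
      Or.inr (Or.inr ⟨rfl, by show b = min b a; rw [min_eq_left hab], hbc, hac⟩)⟩

/-! ## Unpacking the Boolean certificates -/

/-- `domV n V₀`: every listed shape of every volume of `[V₀, V₀+n)` is dominated. [bookkeeping] -/
theorem domV_sound : ∀ (n V₀ : ℕ), TAStatF.domV n V₀ = true → ∀ V, V₀ ≤ V → V < V₀ + n →
    ∀ x ∈ TAStatF.triplesS V, TAStatF.domX V (gainOf2371j V) x = true
  | 0, V₀, _, V, h1, h2, _, _ => by omega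
  | n + 1, V₀, h, V, h1, h2, x, hx => by
    have hunf : domV (n + 1) V₀ = ((triplesS V₀).all (domX V₀ (gainOf2371j V₀)) && domV n (V₀ + 1)) := rfl
    rw [hunf, Bool.and_eq_true] at h
    rcases Nat.eq_or_lt_of_le h1 with rfl | hlt
    · exact List.all_eq_true.1 h.1 x hx
    · exact domV_sound n (V₀ + 1) h.2 V hlt (by omega) x hx

/-- `domXTV n V₀`: every listed shape of every volume of `[V₀, V₀+n)` is dominated at the extra entries. [bookkeeping] -/
theorem domXTV_sound : ∀ (n V₀ : ℕ), TAStatF.domXTV n V₀ = true → ∀ V, V₀ ≤ V → V < V₀ + n →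
    ∀ x ∈ TAStatF.triplesS V, TAStatF.domXTall V (gainOf2371j V) x = true
  | 0, V₀, _, V, h1, h2, _, _ => by omega
  | n + 1, V₀, h, V, h1, h2, x, hx => by
    have hunf : domXTV (n + 1) V₀ = ((triplesS V₀).all (domXTall V₀ (gainOf2371j V₀)) && domXTV n (V₀ + 1)) := rfl
    rw [hunf, Bool.and_eq_true] at h
    rcases Nat.eq_or_lt_of_le h1 with rfl | hlt
    · exact List.all_eq_true.1 h.1 x hx
    · exact domXTV_sound n (V₀ + 1) h.2 V hlt (by omega) x hx

/-- `domXTrow`, member form. [bookkeeping] -/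
theorem domXTrow_sound {g V p : ℕ} {xs : List (ℕ × ℕ × ℕ)} (h : TAStatF.domXTrow g V p xs = true) :
    ∀ e ∈ xs, V < e.1 * p ∧ g * e.2.2 ≤ e.2.1 * (e.1 * p - V) := by
  intro e he
  simp only [domXTrow, List.all_eq_true, Bool.and_eq_true, Nat.blt_eq, Nat.ble_eq] at h
  exact h e he

/-- `xdenOK`, member form: the extra entries of a level `< nl` and a bucket `< nb` have parameters `≥ 3` and positive denominators. [bookkeeping] -/
theorem xdenOK_sound (h : TAStatF.xdenOK = true) : ∀ i < TAStatFData.nl, ∀ j < TAStatFData.nb, ∀ e ∈ TAStatF.xrow i j, 3 ≤ e.1 ∧ 1 ≤ e.2.2 := by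
  intro i hi j hj e he
  by_cases hg : TAStatF.ix0 ≤ i ∧ TAStatF.jx0 ≤ j
  · simp only [xdenOK, List.all_eq_true, List.mem_range, Bool.and_eq_true, Nat.ble_eq] at h
    have := h (i - TAStatF.ix0) (by omega) (j - TAStatF.jx0) (by omega)
    rw [show TAStatF.ix0 + (i - TAStatF.ix0) = i by omega, show TAStatF.jx0 + (j - TAStatF.jx0) = j by omega] at this
    exact this e he
  · simp only [xrow, if_neg hg] at he
    simp at he

/-- `checkV n V₀`: every listed shape of every volume of `[V₀, V₀+n)` passes `checkShape`. [bookkeeping] -/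
theorem checkV_sound (Lo Hi : ℕ) : ∀ (n V₀ : ℕ), TAStatF.checkV Lo Hi n V₀ = true → ∀ V, V₀ ≤ V → V < V₀ + n →
    ∀ x ∈ TAStatF.triplesS V, TAStatF.checkShape Lo Hi V (gainOf2371j V) x = true
  | 0, V₀, _, V, h1, h2, _, _ => by omega
  | n + 1, V₀, h, V, h1, h2, x, hx => by
    have hunf : checkV Lo Hi (n + 1) V₀ = ((triplesS V₀).all (checkShape Lo Hi V₀ (gainOf2371j V₀)) && checkV Lo Hi n (V₀ + 1)) := rfl
    rw [hunf, Bool.and_eq_true] at h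
    rcases Nat.eq_or_lt_of_le h1 with rfl | hlt
    · exact List.all_eq_true.1 h.1 x hx
    · exact checkV_sound Lo Hi n (V₀ + 1) h.2 V hlt (by omega) x hx

/-- `domWrow` along a dropped row: domination at every bucket `j′ ∈ [j, row.length)`. [bookkeeping] -/
theorem domWrow_sound (g V p : ℕ) : ∀ (es : List Entry) (j : ℕ), TAStatF.domWrow g V p es j = true →
    ∀ k, k < es.length → V < TAStatF.tp (j + k) * p ∧ g * (es.getD k e0).2.2.2 ≤ (es.getD k e0).2.2.1 * (TAStatF.tp (j + k) * p - V)
  | [], j, _, k, hk => by simp at hk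
  | e :: es, j, h, k, hk => by
    have hunf : domWrow g V p (e :: es) j =
        (Nat.blt V (tp j * p) && Nat.ble (g * e.2.2.2) (e.2.2.1 * (tp j * p - V)) && domWrow g V p es (j + 1)) := rfl
    rw [hunf, Bool.and_eq_true, Bool.and_eq_true, Nat.blt_eq, Nat.ble_eq] at h
    obtain ⟨⟨h1, h2⟩, h3⟩ := h
    cases k with
    | zero => simpa using ⟨h1, h2⟩
    | succ k =>
      have hk' : k < es.length := by simpa using hk
      have := domWrow_sound g V p es (j + 1) h3 k hk'
      simpa [Nat.add_right_comm j 1 k, Nat.add_assoc] using this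

/-- `m2V n V₀`: on the volumes `[V₀, V₀+n)` every listed sorted shape whose bucket (of `x.1·x.2.1`) is flagged lies in that bucket's second-member list. [bookkeeping] -/
theorem m2V_sound : ∀ (n V₀ : ℕ), TAStatF.m2V n V₀ = true → ∀ V, V₀ ≤ V → V < V₀ + n →
    ∀ x ∈ TAStatF.triplesS V, TAStatF.m2f (TAStatF.bucketOf (x.1 * x.2.1)) = true → x ∈ TAStatF.m2l (TAStatF.bucketOf (x.1 * x.2.1))
  | 0, V₀, _, V, h1, h2, _, _, _ => by omega
  | n + 1, V₀, h, V, h1, h2, x, hx, hf => by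
    have hunf : m2V (n + 1) V₀ = ((triplesS V₀).all (fun x => !(m2f (bucketOf (x.1 * x.2.1))) || (m2l (bucketOf (x.1 * x.2.1))).elem x) &&
        m2V n (V₀ + 1)) := rfl
    rw [hunf, Bool.and_eq_true] at h
    rcases Nat.eq_or_lt_of_le h1 with rfl | hlt
    · have hx' := List.all_eq_true.1 h.1 x hx
      rw [Bool.or_eq_true, hf] at hx'
      rcases hx' with hneg | hel
      · simp at hneg
      · exact List.elem_iff.1 hel
    · exact m2V_sound n (V₀ + 1) h.2 V hlt (by omega) x hx hf

end Summit.MatrixMultiplication.MatrixMultiplication.Theorems.TAStatF
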